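import Mathlib
import HarnessLib
import Summits.HubbardSuperconductivity.HubbardSuperconductivity.Theorems.KLProgrammeKLRegimeRenormFlowV17F
import Summits.HubbardSuperconductivity.HubbardSuperconductivity.Theorems.KLProgrammeKLRegimeSplitSlotsV17F2

/-!
# Route `KLProgramme` — gen-8 (7-flow, cure 1) child 2-F2 `KLRegimeRenormFlowV17F2 := CountertermP2 klPredsV17F2 klWindowC`: THE FORWARD INDUCTION, re-keyed
# (plan g16 K3-FLOW RULING F, S4(b)/S5; S1 rev 2 = `…SplitSlotsV17F2` p527694 (cure 1 of k3c2-p2's (E2-F) ball finding, KL STATUS l.2646/2704); seat hubbard-kl-k3c3-p2)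

`klPredsV17F2` differs from `klPredsV17F` ONLY in the engine / two-leg slots (`PairLadderStepAtV17F2` reads the bare-truncated array `klPairArrayF`); its
`frameOK`, `renorm` (= `RenormFlowAtV17F`) and `split` fields are `klPredsV17F`'s by `rfl`, and `TwoLegStepV17F2.readJets` still yields `TwoLegReadJetsF`.
Hence child 2-F2 is the V17F forward induction (`…RenormFlowV17F`, p527398) VERBATIM with one token re-keyed: the step lemmas
`renormalisedAtF_flow_of_readJets`, `flowGeometry_of_pieceJets`, `flowPieceJetsAt_of_readJetsF_at` (jets step = k3c3-p3's p524080 keyed to the flow) are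
bundle-free and imported.  Result: **`countertermP2_klPredsV17F2_holds : CountertermP2 klPredsV17F2 klWindowC`**, unconditional — the text of the route decl
`…Theses.KLProgramme.KLRegimeRenormFlowV17F2` (item 20439).  Proofs only; nothing here asserts superconductivity.
-/

noncomputable section

namespace Summit.HubbardSuperconductivity.HubbardSuperconductivity.Theorems.KLRegimeSplit

set_option linter.dupNamespace false -- summit = problem name (single-conjunct summit), D-0017

open Real Finset
open Literature.MathematicalPhysics.QuantumLattice Literature.Probability.LatticeModels

/-! ## The forward induction -/

/-- **CHILD 2-F2 (cure 1) OF THE FLOWING-DISPERSION SPLIT, FROM THE JETS STEP** (the V17F proof verbatim, re-keyed `klPredsV17F ↦ klPredsV17F2`; the renorm slot `RenormFlowAtV17F`, the reading `TwoLegReadJetsF` and the pieces `FlowPieceJetsAt`/`FlowGeometryAt` are UNCHANGED names).  Let `Rf G` be a renormalisation package depending on `G` only, well formed with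
positive tolerances, whose mismatch constant absorbs the k = 0 reading (`G.S 0 + 1 ≤ (Rf G).cr / 32`), and let `hJ` be the jets step (the flow piece
`klFlowPiece … n` — Jackson mean of the tube extension of the cumulative reading — has the jets of an admissible `(Rf G)`-piece whenever the reading has
the (E3a-F) jets, below a smallness `U_J(G, Q)`).  Then `CountertermP2 klPredsV17F2 klWindowC`. -/
theorem countertermP2_klPredsV17F2_of_jetsStep (Rf : GeoConsts → RenConsts)
    (hRf : ∀ G : GeoConsts, G.WF → (Rf G).WF2)
    (hcr : ∀ G : GeoConsts, G.WF → G.S 0 + 1 ≤ (Rf G).cr / 32)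
    (hJ : ∀ (G : GeoConsts) (Q : EngConsts), G.WF → Q.WF → ∃ UJ : ℝ, 0 < UJ ∧
      ∀ (L M : ℕ) [NeZero L] [NeZero M] (β U μ : ℝ) (n : ℕ), 0 < U → U ≤ UJ → klBetaMin ≤ β → μ ∈ klWindowC →
        TwoLegReadJetsF L M G Q β U μ n → FlowPieceJetsAt L M β U μ (Rf G) n) :
    CountertermP2 klPredsV17F2 klWindowC := by
  intro G P hG _hP
  refine ⟨Rf G, hRf G hG, fun Q hQ => ?_⟩
  have hR : ∀ j, 0 ≤ (Rf G).Gfr j := (hRf G hG).1.2.2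
  have hS'0 : 0 ≤ Q.S' 0 := hQ.2.2.2.2.1 0
  -- thresholds: the allowance sums (c₂, U₂), the jets step (UJ), the reading fit (U ≤ 1/(S′₀+1))
  obtain ⟨c₂, hc₂, U₂, hU₂, hsums⟩ := allowanceSums_thresholds hR
  obtain ⟨UJ, hUJ, hJ'⟩ := hJ G Q hG hQ
  refine ⟨c₂, hc₂, fun c hc0 hcle => ⟨min U₂ (min UJ (1 / (Q.S' 0 + 1))), lt_min hU₂ (lt_min hUJ (by positivity)), ?_⟩⟩
  intro μ hμ U hU hUle β hβ hβc Lh Mh hhyp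
  have hU2 : U ≤ U₂ := hUle.trans (min_le_left _ _)
  have hUJ' : U ≤ UJ := hUle.trans ((min_le_right _ _).trans (min_le_left _ _))
  have hUS : U ≤ 1 / (Q.S' 0 + 1) := hUle.trans ((min_le_right _ _).trans (min_le_right _ _))
  obtain ⟨h0, h1, h2⟩ := hsums c U β hc0.le hcle hU hU2 hβ hβc
  have hμw : μ ∈ Set.Icc (-1.05 : ℝ) (-0.15) := hμ
  -- the reading fit `S₀ + S′₀|U| ≤ cr/32` from `U ≤ 1/(S′₀+1)`
  have hfit : G.S 0 + Q.S' 0 * |U| ≤ (Rf G).cr / 32 := by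
    have habs : |U| = U := abs_of_pos hU
    have h1' : Q.S' 0 * U ≤ 1 := by
      have := mul_le_mul_of_nonneg_left hUS hS'0
      have hS1 : Q.S' 0 * (1 / (Q.S' 0 + 1)) ≤ 1 := by
        rw [mul_one_div, div_le_one (by positivity)]; linarith
      exact this.trans hS1
    rw [habs]; linarith [hcr G hG]
  -- the dummy frame: `0`, admissible by the allowance sums
  have hzero : FrameOK (Rf G) U (nScales β) μ (0 : TrigPolyC4v) := frameOK_zero_of_sums hR hμw h0 h1 h2
  refine ⟨0, ⟨rfl, hzero⟩, Lh, Mh, fun L M _ _ hL hM => ?_⟩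
  -- strong induction on the scale, at the volume `(L, M)`
  have hmain : ∀ n : ℕ, n ≤ nScales β → RenormFlowAtV17F L M β U μ (Rf G) n := by
    intro n
    induction n using Nat.strong_induction_on with
    | _ n ih =>
      intro hn
      have hhist : ∀ j < n, klPredsV17F2.renorm L M β U μ (0 : TrigPolyC4v) (Rf G) j :=
        fun j hj => ih j hj ((le_of_lt hj).trans hn)
      obtain ⟨-, htwo, -⟩ := hhyp 0 ⟨rfl, hzero⟩ L M hL hM n hn hhist
      have hjets : TwoLegReadJetsF L M G Q β U μ n := htwo.readJets
      -- (b) the jets of the new piece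
      have hPn : FlowPieceJetsAt L M β U μ (Rf G) n := hJ' L M β U μ n hU hUJ' hβ hμ hjets
      have hPall : ∀ m ≤ n, FlowPieceJetsAt L M β U μ (Rf G) m := by
        intro m hm
        rcases Nat.lt_or_ge m n with hlt | hge
        · exact (ih m hlt ((le_of_lt hlt).trans hn)).2.1
        · have : m = n := le_antisymm hm hge
          rw [this]; exact hPn
      -- (c) the geometry of the next band, from the pieces `m ≤ n` and the sums over `m ≤ n ≤ n_β`
      have hsub : range (n + 1) ⊆ range (nScales β + 1) := range_mono (show n + 1 ≤ nScales β + 1 by omega)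
      have hterm0 : ∀ m, 0 ≤ (Rf G).Gfr 0 * uPow 0 U * (4 : ℝ) ^ (((0 : ℤ) - 2) * m) := fun m =>
        mul_nonneg (mul_nonneg (hR 0) (uPow_nonneg 0 U)) (zpow_nonneg (by norm_num) _)
      have hterm1 : ∀ m, 0 ≤ (Rf G).Gfr 1 * uPow 1 U * (4 : ℝ) ^ (((1 : ℤ) - 2) * m) := fun m =>
        mul_nonneg (mul_nonneg (hR 1) (uPow_nonneg 1 U)) (zpow_nonneg (by norm_num) _)
      have hterm2 : ∀ m, 0 ≤ ∑ j ∈ range 3, (Rf G).Gfr j * uPow j U * (4 : ℝ) ^ (((j : ℤ) - 2) * m) := fun m =>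
        sum_nonneg fun j _ => mul_nonneg (mul_nonneg (hR j) (uPow_nonneg j U)) (zpow_nonneg (by norm_num) _)
      have h0n := (sum_le_sum_of_subset_of_nonneg hsub fun m _ _ => hterm0 m).trans h0
      have h1n := (sum_le_sum_of_subset_of_nonneg hsub fun m _ _ => hterm1 m).trans h1
      have h2n := (sum_le_sum_of_subset_of_nonneg hsub fun m _ _ => hterm2 m).trans h2
      have hgeo : FlowGeometryAt L M β U μ n := flowGeometry_of_pieceJets hμ hR hPall h0n h1n h2n
      exact ⟨renormalisedAtF_flow_of_readJets hjets hfit, hPn, hgeo⟩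
  intro n hn
  exact hmain n hn

/-! ## The unconditional closer -/

/-- **Child 2-F2 of the gen-8 re-split CLOSES**: `CountertermP2 klPredsV17F2 klWindowC` — the forward induction at the package
`G ↦ ⟨32·(G.S 0 + 1) + 32, 1, 2·(curveExtC X G.S · + 1)⟩`, `X` the cutoff-derivative constant of `exists_norm_iteratedFDeriv_salmhoferCutoff_le_all 4`, with the
jets step `flowPieceJetsAt_of_readJetsF_at` (…RenormFlowV17F §3, from p524080). -/
theorem countertermP2_klPredsV17F2_holds : CountertermP2 klPredsV17F2 klWindowC := by
  obtain ⟨X, hX1, hX⟩ := exists_norm_iteratedFDeriv_salmhoferCutoff_le_all 4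
  have hX0 : 0 ≤ X := by linarith
  refine countertermP2_klPredsV17F2_of_jetsStep (fun G => ⟨32 * (G.S 0 + 1) + 32, 1, fun j => 2 * (curveExtC X G.S j + 1)⟩)
    (fun G hG => ?_) (fun G _ => ?_) (fun G Q hG hQ => flowPieceJetsAt_of_readJetsF_at X hX1 hX G Q hG hQ)
  · have hS : ∀ j, 0 ≤ G.S j := hG.2.2.2.2.2.2.2.2.2.2.2.2.2.2.2.2.2.1
    refine ⟨⟨?_, by norm_num, fun j => ?_⟩, ?_, by norm_num⟩
    · show (0 : ℝ) ≤ 32 * (G.S 0 + 1) + 32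
      have := hS 0; positivity
    · show (0 : ℝ) ≤ 2 * (curveExtC X G.S j + 1)
      have := curveExtC_nonneg hX0 hS j; positivity
    · show (0 : ℝ) < 32 * (G.S 0 + 1) + 32
      have := hS 0; positivity
  · show G.S 0 + 1 ≤ (32 * (G.S 0 + 1) + 32) / 32
    linarith

end Summit.HubbardSuperconductivity.HubbardSuperconductivity.Theorems.KLRegimeSplit

end
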